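import Literature.Computability.QuantumComplexity.JonesDigest
import HarnessLib

/-!
# The digest of an AJL instance as an explicit string

Topic `Literature/Computability/QuantumComplexity`; a step in the discharge of
`ajl_jonesApproxProblem_mem_PromiseBQP` (and, through `PromiseBQPOverTransport.lean`, of
`ajl_mem_PromiseBQPOver_ajlGateSet`): the remaining classical hypothesis of
`AJLCore.mem_PromiseBQP_of_uniform_of_digest'` (`JonesPostFP.lean`) asks for a polynomial-time string
function agreeing with the digest `AJLCore.digest` (`JonesDigest.lean`) on the encodings of valid
instances. The digest `digestRaw x` is defined through indexed reads (`tabBitRaw`: slot `v / A`,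
letter index `v % A`; `patField`: the position encoding `encodePos` of the zigzag walk `|α⟩`); a
string program produces it block by block. This file gives that block form, with no reference to the
path model or to the circuit:

* `oneHot A i`, `slotBlock A (cw[s]?)` — the one-hot table of one letter slot (`A = 2(2t - 1)` bits,
  bit `2j + σ` for the letter `σ_j^{σ}`; zeros for an empty slot), `tabList t cw` — the `t` slot
  blocks of the compressed word `cw`, `patList t = [w % 4 = 3 | w < 2(2t+1)]` — the code
  `00 01 00 01 … 00` of the vertex sequence `1,2,1,2,…,1` of `|α⟩` (`vertexHigh`/`vertexLow`);
* `getElem?_flatten_blocks` — reading a concatenation of equal-length blocks by quotient and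
  remainder;
* **`tabField_eq`**, **`patField_eq`**, **`digestRaw_eq_blocks`**:
  `digestRaw x = tabList t (cword x).2 ++ patList t ++ 0^{16t² - t·A - 2(2t+1)}` with `t = tI x`
  (the compressed word `cword x` is made explicit by `StrandCompressClosedForm.compressRaw_instance_eq`).

## References

* D. Aharonov, V. Jones, Z. Landau, Algorithmica 55 (2009) = arXiv:quant-ph/0511096, §3.3
  (Algorithm Approximate-Jones-Plat-Closure: the input to the circuit is the braid word and
  `|α⟩ = |1010…10⟩`), §2.12 (paths presented by their sequence of vertices) [AharonovJonesLandau2009].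
-/

namespace Literature.Computability.QuantumComplexity

open Cryptography BlockKit

namespace AJLCore

/-! ### Blocks -/

/-- The one-hot string of length `A` with its `1` at position `i` (all zeros if `A ≤ i`). [folklore] -/
def oneHot (A i : ℕ) : List Bool := (List.range A).map fun v => decide (i = v)

/-- The table block of a slot: the one-hot code `2j + σ` of its letter `σ_j^{σ}`, zeros if the slot is
empty. [cite: AharonovJonesLandau2009, §3.3] -/
def slotBlock (A : ℕ) : Option (ℕ × Bool) → List Bool
  | some g => oneHot A (2 * g.1 + g.2.toNat)
  | none => List.replicate A false

/-- The table field in block form: `t` slots of `A (2t) = 2(2t - 1)` bits spelling the word `cw`.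
[cite: AharonovJonesLandau2009, §3.3] -/
def tabList (t : ℕ) (cw : List (ℕ × Bool)) : List Bool :=
  ((List.range t).map fun s => slotBlock (A (2 * t)) cw[s]?).flatten

/-- The pattern field in closed form: the vertex codes `00, 01, 00, 01, …, 00` of the zigzag walk
`1, 2, 1, 2, …, 1` on `2t` steps, i.e. bit `w` is `1` iff `w ≡ 3 (mod 4)`. [cite: AharonovJonesLandau2009, §2.12 and §3.3] -/
def patList (t : ℕ) : List Bool := (List.range (2 * (2 * t + 1))).map fun w => decide (w % 4 = 3)

/-- `|oneHot A i| = A`. [folklore] -/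
@[simp] theorem length_oneHot (A i : ℕ) : (oneHot A i).length = A := by simp [oneHot]

/-- `|slotBlock A o| = A`. [folklore] -/
@[simp] theorem length_slotBlock (A : ℕ) (o : Option (ℕ × Bool)) : (slotBlock A o).length = A := by
  cases o <;> simp [slotBlock]

/-- `|patList t| = 2(2t+1)`. [folklore] -/
@[simp] theorem length_patList (t : ℕ) : (patList t).length = 2 * (2 * t + 1) := by simp [patList]

/-- Reading a concatenation of blocks of equal positive length `A`: position `v` is position `v % A`
of block `v / A`. [folklore] -/
theorem getElem?_flatten_blocks {A : ℕ} (hA : 0 < A) : ∀ (bs : List (List Bool)) (v : ℕ),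
    (∀ b ∈ bs, b.length = A) → bs.flatten[v]? = bs[v / A]?.bind fun b => b[v % A]?
  | [], v, _ => by simp
  | b :: bs, v, h => by
    have hb : b.length = A := h b (by simp)
    rw [List.flatten_cons]
    by_cases hv : v < A
    · rw [List.getElem?_append_left (by rw [hb]; exact hv), Nat.div_eq_of_lt hv, Nat.mod_eq_of_lt hv]
      simp
    · push Not at hv
      rw [List.getElem?_append_right (by rw [hb]; exact hv), hb,
        getElem?_flatten_blocks hA bs (v - A) fun b' hb' => h b' (by simp [hb']),
        show v / A = (v - A) / A + 1 by rw [← Nat.add_div_right _ hA, Nat.sub_add_cancel hv],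
        show v % A = (v - A) % A by rw [← Nat.add_mod_right (v - A) A, Nat.sub_add_cancel hv]]
      simp

/-- `|tabList t cw| = t · A (2t)`. [folklore] -/
theorem length_tabList (t : ℕ) (cw : List (ℕ × Bool)) : (tabList t cw).length = t * A (2 * t) := by
  unfold tabList
  rw [List.length_flatten, List.map_map]
  have : (List.length ∘ fun s : ℕ => slotBlock (A (2 * t)) cw[s]?) = fun _ => A (2 * t) := by
    funext s; simp
  rw [this, List.map_const', List.sum_replicate, List.length_range, smul_eq_mul]

/-- Entries of `tabList`: position `v < t·A` reads bit `v % A` of the block of slot `v / A`. [folklore] -/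
theorem getElem?_tabList (t : ℕ) (cw : List (ℕ × Bool)) {v : ℕ} (hv : v < t * A (2 * t)) :
    (tabList t cw)[v]? = some (match cw[v / A (2 * t)]? with
      | some g => decide (2 * g.1 + g.2.toNat = v % A (2 * t))
      | none => false) := by
  have hA : 0 < A (2 * t) := Nat.pos_of_ne_zero fun h => by rw [h, Nat.mul_zero] at hv; exact Nat.not_lt_zero _ hv
  have hs : v / A (2 * t) < t := (Nat.div_lt_iff_lt_mul hA).2 hv
  have hm : v % A (2 * t) < A (2 * t) := Nat.mod_lt _ hA
  unfold tabList
  rw [getElem?_flatten_blocks hA _ _ (fun b hb => by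
      rw [List.mem_map] at hb; obtain ⟨s, -, rfl⟩ := hb; exact length_slotBlock _ _),
    List.getElem?_map, List.getElem?_range hs, Option.map_some, Option.bind_some]
  cases cw[v / A (2 * t)]? with
  | none => rw [slotBlock, List.getElem?_replicate, if_pos hm]
  | some g => rw [slotBlock, oneHot, List.getElem?_map, List.getElem?_range hm, Option.map_some]

/-! ### The fields of the digest in block form -/

/-- **The table field is the block table of the compressed word.** [cite: AharonovJonesLandau2009, §3.3] -/
theorem tabField_eq (x : RawJonesInstance) : tabField x = tabList (tI x) (cword x).2 := by
  apply List.ext_getElem?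
  intro v
  by_cases hv : v < tI x * A (2 * tI x)
  · rw [getElem?_tabList _ _ hv, tabField, List.getElem?_map, List.getElem?_range hv, Option.map_some]
    rfl
  · rw [List.getElem?_eq_none (by rw [tabField, List.length_map, List.length_range]; omega),
      List.getElem?_eq_none (by rw [length_tabList]; omega)]

/-- The vertices of the zigzag walk `|α⟩`: `1` after an even number of steps, `2` after an odd one.
[cite: AharonovJonesLandau2009, §3.3 and Claim 3.8] -/
theorem pathPos_ajlAlpha {n : ℕ} (j : ℕ) (hj : j ≤ n) : pathPos (ajlAlpha n) j = if j % 2 = 0 then 1 else 2 := by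
  obtain ⟨l, rfl | rfl⟩ := Nat.even_or_odd' j
  · rw [if_pos (by omega)]
    exact pathPos_of_altPrefix (p := ajlAlpha n) (fun t _ => rfl) hj
  · have h1 : pathPos (ajlAlpha n) (2 * l) = 1 := pathPos_of_altPrefix (p := ajlAlpha n) (fun t _ => rfl) (by omega)
    rw [if_neg (by omega), pathPos_succ _ (by omega), h1]
    simp [ajlAlpha]

/-- **The pattern field is `patList`.** [cite: AharonovJonesLandau2009, §2.12 and §3.3] -/
theorem patField_eq (x : RawJonesInstance) : patField x = patList (tI x) := by
  unfold patField patList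
  apply List.ext_getElem
  · simp only [List.length_ofFn, List.length_map, List.length_range]; try omega
  · intro w h1 h2
    rw [List.length_ofFn] at h1
    rw [List.getElem_ofFn, List.getElem_map, List.getElem_range]
    simp only [encodePos]
    rw [pathPos_ajlAlpha (w / 2) (by omega)]
    by_cases h0 : w % 2 = 0
    · rw [if_pos h0]; split_ifs with h <;> simp [vertexHigh] <;> omega
    · rw [if_neg h0]; split_ifs with h <;> simp [vertexLow] <;> omega

/-- **The digest in block form**: table blocks, pattern, zero padding to length `16 t²`.
[cite: AharonovJonesLandau2009, §3.3] -/
theorem digestRaw_eq_blocks (x : RawJonesInstance) :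
    digestRaw x = tabList (tI x) (cword x).2 ++ patList (tI x) ++
      List.replicate (16 * tI x ^ 2 - tI x * A (2 * tI x) - 2 * (2 * tI x + 1)) false := by
  rw [digestRaw, tabField_eq, patField_eq, length_tabList, length_patList]

/-- The same for the digest of the encoding of an instance. [cite: AharonovJonesLandau2009, §3.3] -/
theorem digest_encode_eq_blocks (x : RawJonesInstance) :
    digest (RawJonesInstance.encoding.encode x) = tabList (tI x) (cword x).2 ++ patList (tI x) ++
      List.replicate (16 * tI x ^ 2 - tI x * A (2 * tI x) - 2 * (2 * tI x + 1)) false := by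
  rw [digest_encode, digestRaw_eq_blocks]

end AJLCore

end Literature.Computability.QuantumComplexity
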